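import Literature.Analysis.UnboundedOperators.LinearizedBoltzmann
import Literature.Analysis.FluidPDE.HardSphereCollisionRecord
import Literature.MathematicalPhysics.KineticTheory.HardSphereEuler

/-!
# Vocabulary of the line `clamped-corrector-innovations` for the crux `TwoClocks.EquilibriumFastWindowLD`
(stmt-AtomisticToContinuum-14440; route TwoClocks, rank 2)

Definitions-only support file (`--supports stmt-AtomisticToContinuum-14440`) of the line lead
(skeleton `Cruxes/EquilibriumFastWindowLD/Lines/clamped_corrector_innovations.lean`, planner crux-plan, triage
r1-1/r1-2 pass; skeleton registered on the item with the six stubs `stub_correctorOperator`,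
`stub_angleInnovation`, `stub_partnerInnovation`, `stub_activityCensus`, `stub_staticSecondOrder`,
`stub_correctorIdentity`). It makes the line's vocabulary IMPORTABLE so that each registered stub can land in its
own sorry-free Theorems file with the registered signature verbatim. All bodies are copied byte-for-byte from the
skeleton's §Frame and §Objects (the violation predicate is realised as the `{0,1}`-valued flag `violFlag`, and the
kinematic-centring hypothesis of stub 2 is written out in the stub, so that this file declares NO `Prop`);
nothing is asserted here (no `def … : Prop`, no statement of a stub or of the crux — those stay in the route file /
the skeleton).

Objects (window `w = τ (N+1)^{-1/3}`, diameter `ε_N = hsDiameter σ N`, canonical Gibbs law `gibbs` = `localGibbsLaw`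
with constant profiles): the transfer activity `act`, collision count `cnt` and cumulative kinetic energy `cumEnergy`
of one particle on `(0, t]`; the energy-normalised violation flag `violFlag` and the running first-violation clamp
`clamp`; the clamped angle-innovation stream `angleStream`; the pair flux `flux`; the locality kernel `bump`; the equilibrium contact value `contactValue` (from the equation of state
`hsCompressibility`); the clamped partner/rate-innovation stream `partnerStream` with its local Enskog compensator;
the local mean energy `localMeanEnergy` and the census functional `censusFunctional`.
prover-line-stmt-AtomisticToContinuum-14440-a1-0, 2026-08-17.
-/

noncomputable section

open MeasureTheory ProbabilityTheory Real Set Filter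
open scoped ENNReal BigOperators InnerProductSpace Classical

namespace Summit.AtomisticToContinuum.HydrodynamicLimit.Theorems.ClampedCorrector

open Literature.Analysis.FluidPDE Literature.MathematicalPhysics.KineticTheory

/-! ## Frame -/

/-- The hard-sphere flow type of the conjunct at reduced density `σ`, `N + 1` spheres. -/
abbrev Flow (σ : ℝ) (N : ℕ) : Type :=
  HardSphereFlow (Torus.geometry (Fin 3)) (hsDiameter σ N) (N + 1)

/-- The kinetic window `w_N = τ (N+1)^{-1/3}` (`≍ τσ²√θ₀` mean free times). -/
def window (τ : ℝ) (N : ℕ) : ℝ := τ * ((N : ℝ) + 1) ^ (-(1 / 3 : ℝ))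

/-- The canonical Gibbs law with constant profiles (the flow-invariant reference of the crux). -/
def gibbs (σ a₀ θ₀ : ℝ) (u₀ : V3) (N : ℕ) (Φ : Flow σ N) : Measure (Config (N + 1) (Fin 3) T3) :=
  localGibbsLaw σ (fun _ => a₀) (fun _ => u₀) (fun _ => θ₀) N Φ

/-! ## Objects of the line -/

/-- Transfer ACTIVITY of particle `i` up to time `t`: `(σ/τ) Σ_{own collisions in (0,t]} ‖v_i⁺ - v_i⁻‖`
(ordered records with `fst = i`: each collision of `i` exactly once). Non-decreasing in `t`. -/
def act (σ τ : ℝ) (N : ℕ) (Φ : Flow σ N) (i : Fin (N + 1)) (t : ℝ)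
    (z : Config (N + 1) (Fin 3) T3) : ℝ :=
  σ / τ * Φ.collisionSum (Set.Ioc 0 t)
    (fun c => if c.fst = i then ‖c.postVel.1 - c.preVel.1‖ else 0) z

/-- Collision COUNT of particle `i` up to time `t`. Non-decreasing in `t`. -/
def cnt (σ : ℝ) (N : ℕ) (Φ : Flow σ N) (i : Fin (N + 1)) (t : ℝ)
    (z : Config (N + 1) (Fin 3) T3) : ℝ :=
  Φ.collisionSum (Set.Ioc 0 t) (fun c => if c.fst = i then (1 : ℝ) else 0) z

/-- Cumulative kinetic energy of particle `i` up to time `t`, `∫₀ᵗ ‖v_i(r)‖² dr` (non-decreasing; the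
MONOTONE normaliser of the clamp: a particle that is genuinely fast earns a proportionally larger
activity/count allowance, a Newton-cradle relay sphere — fast only during one flight of length `ε` — does
not). -/
def cumEnergy (σ : ℝ) (N : ℕ) (Φ : Flow σ N) (i : Fin (N + 1)) (t : ℝ)
    (z : Config (N + 1) (Fin 3) T3) : ℝ :=
  ∫ r in (0 : ℝ)..t, ‖(Φ.flow r z i).2‖ ^ 2

/-- **Violation flag** `∈ {0,1}` of particle `i` at time `s`: `1` iff `i` VIOLATES the energy-normalised
allowances at time `s` — activity `> V (1 + cumEnergy/w)` or count `> V τ (1 + √(cumEnergy/w))` (`w` the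
kinetic window). Typical particles of ANY speed satisfy both once `V ≥ V₀ ≍ π(σ³θ₀ ∨ σ²√θ₀)`; violation
needs an anomalous collision count relative to the own path (cage, platoon, dense tube: large-deviation
cost growing with `τ`) or a single kick `≳ Vτ/σ` (Gaussian cost `∝ τ²`), so the OFF population vanishes as
`τ → ∞` at FIXED `V` — while a relay packet through an on-sphere is still capped at `Vτ(1+θ₀)/σ`. -/
def violFlag (σ τ V : ℝ) (N : ℕ) (Φ : Flow σ N) (i : Fin (N + 1)) (s : ℝ)
    (z : Config (N + 1) (Fin 3) T3) : ℝ :=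
  if V * (1 + cumEnergy σ N Φ i s z / window τ N) < act σ τ N Φ i s z ∨
      V * τ * (1 + Real.sqrt (cumEnergy σ N Φ i s z / window τ N)) < cnt σ N Φ i s z
  then 1 else 0

/-- **Running one-particle clamp** `ω_i(t) ∈ {0,1}` (first-violation form): particle `i` is ON at time
`t` iff none of its own collision records in `(0,t]` carries the violation flag (activity and count jump
only at own collisions and the allowances are non-decreasing, so this is "no violation at any time `≤ t`").
Non-increasing in `t` by construction (switches off at most once, at an own collision); `ω_i(0) = 1`. -/
def clamp (σ τ V : ℝ) (N : ℕ) (Φ : Flow σ N) (i : Fin (N + 1)) (t : ℝ)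
    (z : Config (N + 1) (Fin 3) T3) : ℝ :=
  if Φ.collisionSum (Set.Ioc 0 t)
        (fun c => if c.fst = i then violFlag σ τ V N Φ i c.time z else 0) z = 0
  then 1 else 0

/-- **Clamped angle-innovation stream** `I_w(z) = Σ_{ordered records c, t_c ∈ (0,w]} ω_fst(t_c) ·
h(x_fst, (v_fst⁻,v_snd⁻), (v_fst⁺,v_snd⁺))` along the orbit of `z`. -/
def angleStream (σ τ V : ℝ) (N : ℕ) (Φ : Flow σ N) (h : T3 → V3 × V3 → V3 × V3 → ℝ) (w : ℝ)
    (z : Config (N + 1) (Fin 3) T3) : ℝ :=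
  Φ.collisionSum (Set.Ioc 0 w) (fun c => clamp σ τ V N Φ c.fst c.time z * h c.fstPos c.preVel c.postVel) z

/-- Total hard-sphere flux of an incoming pair, `∫_{S²} ((v-v_*)·ω)₊ dω` (`= π‖v - v_*‖`). -/
def flux (p : V3 × V3) : ℝ :=
  ∫ ω, hardSphereKernel p ω ∂sphereMeasure

/-- The locality kernel `K_η(x,y) = 3/(πη³) · (1 - d(x,y)/η)₊` on the flat torus (minimal-image distance
`Torus.euclidDist`): continuous, `≥ 0`, symmetric, supported in `d < η`, `∫ K_η(x,·) = 1` for `η < 1/2`,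
`‖K_η‖_∞ η³ = 3/π` (shape constant independent of `η`). -/
def bump (η : ℝ) (x y : T3) : ℝ :=
  3 / (Real.pi * η ^ 3) * max (1 - Torus.euclidDist x y / η) 0

/-- The equilibrium CONTACT VALUE `Y(σ)` of the hard-sphere pair correlation at reduced density `σ³`
(diameter units), read off the equation of state `Z = 1 + (2π/3) σ³ Y` (virial theorem;
`hsCompressibility`): `Y = 3 (Z(σ³) - 1)/(2π σ³) = 1 + O(σ³)`. The Enskog factor of the compensator. -/
def contactValue (σ : ℝ) : ℝ :=
  3 * (hsCompressibility (σ ^ 3) - 1) / (2 * Real.pi * σ ^ 3)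

/-- **Clamped partner/rate-innovation stream** `P_w(z)`: the clamped collision sum of the flux-normalised
pair function `m(x_fst; v_fst⁻, v_snd⁻)/flux` MINUS its clamped LOCAL Enskog compensator
`Y ε_N² ∫₀ʷ Σ_{i≠j} ω_i(r) ω_j(r) K_η(x_i(r),x_j(r)) m(x_i(r); v_i(r), v_j(r)) dr` (the Enskog collision
intensity of the ordered pair `(i,j)` at impact `dω` is `Y ε² ((v_i-v_j)·ω)₊ dω ×` the local partner density,
here smoothed at scale `η`). For a stochastic (Boltzmann–Enskog) collision mechanism this is a martingale. -/
def partnerStream (σ τ V η : ℝ) (N : ℕ) (Φ : Flow σ N) (m : T3 → V3 × V3 → ℝ) (w : ℝ)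
    (z : Config (N + 1) (Fin 3) T3) : ℝ :=
  Φ.collisionSum (Set.Ioc 0 w)
      (fun c => clamp σ τ V N Φ c.fst c.time z * (m c.fstPos c.preVel / flux c.preVel)) z -
    contactValue σ * hsDiameter σ N ^ 2 *
      ∫ r in (0 : ℝ)..w, ∑ i : Fin (N + 1), ∑ j : Fin (N + 1),
        if i = j then 0 else
          clamp σ τ V N Φ i r z * clamp σ τ V N Φ j r z *
            (bump η (Φ.flow r z i).1 (Φ.flow r z j).1 * m (Φ.flow r z i).1 ((Φ.flow r z i).2, (Φ.flow r z j).2))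

/-- Local mean kinetic energy around particle `j` in the configuration `y` at scale `η`:
`(Σ_{i≠j} K_η(x_i,x_j) ‖v_i‖²)/(1 + Σ_{i≠j} K_η(x_i,x_j))` (a weighted mean of the neighbours' energies,
`≤ max` neighbour energy; `0` if `j` has no neighbour within `η`). -/
def localMeanEnergy (η : ℝ) (N : ℕ) (y : Config (N + 1) (Fin 3) T3) (j : Fin (N + 1)) : ℝ :=
  (∑ i : Fin (N + 1), if i = j then 0 else bump η (y i).1 (y j).1 * ‖(y i).2‖ ^ 2) /
    (1 + ∑ i : Fin (N + 1), if i = j then 0 else bump η (y i).1 (y j).1)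

/-- **Census functional**: the particles that are OFF at the end of the window, each weighted by
`1 + w⁻¹∫₀ʷ (‖v_j(r)‖² + localMeanEnergy_η(r, j)) dr` — the pathwise price of every off-clamp remainder of
the identity (★) (uncompensated target `Σ_off w⁻¹∫|G| ≤ C'Σ_off(1 + w⁻¹∫|v_j|²)`, switch-off boundary values
`|r(x_i,v_i⁻)| ≤ C_r(1 + |v_i(0)| + (τ/σ)V(1 + w⁻¹∫|v_i|²))`, the on-density deficit
`Σ_off (ρ + local mean energy)`, de-clamping of the U-statistic). -/
def censusFunctional (σ τ V η : ℝ) (N : ℕ) (Φ : Flow σ N) (w : ℝ)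
    (z : Config (N + 1) (Fin 3) T3) : ℝ :=
  ∑ j : Fin (N + 1), (1 - clamp σ τ V N Φ j w z) *
    (1 + w⁻¹ * ∫ r in (0 : ℝ)..w, (‖(Φ.flow r z j).2‖ ^ 2 + localMeanEnergy η N (Φ.flow r z) j))

/-! ## First sanity lemmas (registered sub-goals of the vocabulary file) -/

/-- At time `0` every particle is ON: the window `(0, 0]` is empty, so no own record can carry the
violation flag (`ω_i(0) = 1`, the initial condition of the clamp used by the corrector identity (★)). -/
theorem clamp_zero : ∀ (σ τ V : ℝ) (N : ℕ) (Φ : Flow σ N) (i : Fin (N + 1))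
    (z : Config (N + 1) (Fin 3) T3), clamp σ τ V N Φ i 0 z = 1 := by
  intro σ τ V N Φ i z
  simp [clamp, HardSphereFlow.collisionSum, Literature.Analysis.FluidPDE.collisionSum]

/-- The zero pair test function has zero angle-innovation stream (every record contributes `ω · 0`). -/
theorem angleStream_zero : ∀ (σ τ V : ℝ) (N : ℕ) (Φ : Flow σ N) (w : ℝ)
    (z : Config (N + 1) (Fin 3) T3), angleStream σ τ V N Φ (fun _ _ _ => 0) w z = 0 := by
  intro σ τ V N Φ w z
  simp [angleStream, HardSphereFlow.collisionSum, Literature.Analysis.FluidPDE.collisionSum,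
    Literature.Analysis.FluidPDE.collisionPairSum]

end Summit.AtomisticToContinuum.HydrodynamicLimit.Theorems.ClampedCorrector

end
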